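import Summits.QuantumFields.BalabanUV.Beta.D1BFx.RestKernelSandwichPacked

/-!
# `BalabanUV.Beta.D1BFx.RestKernelSandwichLoc` — road «BF-x» for binder row D1, slot (K), DICT-CHAIN-SPEC §2 (II) row RK-SAND: **«RK-SAND AT
# SELF-LOCALISED PACKS» — THE 1 + 3 SANDWICH CROSS WORDS AT THE ROAD's PACKED N-JETS, WITH THE PACK LETTERS READ FROM THE STENCILS'
# SELF-LOCALISATION** (`LocStencil S Cs δS` for the first-jet pack, the `LocStencil₂` BODY `BiLoc (S₂ κ u κ′ u′) u u (Ck·e^{−δ₂|u′−u|₁}) δ₂` for the pair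
# pack — the letter shapes of (B6′) ∕ PART 3b ∕ leaf-03's (D)): the n-powers DISPLAYED, the constants polynomial in `Cs`, `Ck`, `Zl 4 (δS∕2)`, `Zl 4 (δ₂∕2)`.

HONEST DEPENDENCY (cell records, verbatim): «continuum YM on T⁴ ⇐ BetaPertH ∧ nine spine estimates (0/9 proved); BetaPertH ⇐ (D1) ∧ (D4) ∧
CAP+tail; G-an2-4 gates asym, D1 and NE2/3/4.»  HONEST FRAMING (cell contract, verbatim): «discharging `BetaPertH` makes Bałaban's UV stability
UNCONDITIONAL — a real constructive-QFT result; it is NOT the continuum limit and NOT the Clay problem.»  THIS MODULE DISCHARGES NOTHING of the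
wall: [folklore] `ℓ¹` bookkeeping (the centred weighted mass of a bi-localised kernel) + composition BY NAME of «RK-SAND PACKED-IN-STENCILS»
`RestKernelSandwichPacked.exists_decay510_crossWord_road_packed`; modulo the displayed [B5] hypotheses `h12` ∕ `h126`; 0 `sorry`, 0 definitions,
0 notation, nothing cited.  0 root-level binders of row D1 discharged (hW ∕ hR-sockets ∕ hSX-socket ∕ D1Tel ∕ D1Rep — 0); (K) NOT closed (the road's
N-packs `SN m a S` (leaf-03 (D)) enter through the OWNER's PACK-BRIDGE at `coProjBmAtK (toSite r) n (SN m a S)` — instantiated by the consumer, not here);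
NOT D1, NOT `BetaPertH`, NOT continuum, NOT Clay.

ABSOLUTE RULE (cell charter, verbatim): «No internally-minted statement may enter as a cited fact. Every hypothesis is either kernel-proved in
this package or a verbatim quotation of a PUBLISHED theorem with page reference. The manuscript(s) under audit are NOT citable for their own
disputed steps — they are the thing under adjudication; programme-internal (2001/route/tribunal) claims are never citable.»

CONTENT:
* §1 [any `D`, finite fibre] **`mass_le_of_biLoc`** (`BiLoc K u u C δ`, `σ ≤ δ∕2` ⊢ the `σ`-weighted mass centred at `u` is summable and `≤ |F|²·C·Zl D (δ∕2)²`),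
  `mass_blk_le_of_locStencil` (the blocks of a `LocStencil` pack: `≤ 16·Cs·Zl 4 (δS∕2)²`), `mass_blk_le_of_body` (the blocks of a pair pack with the `LocStencil₂`
  body: plain mass `≤ (16·Ck·Zl 4 (δ₂∕2)²)·e^{−δ₂|u′−u|₁}`).
* §2 [mod `h12 ∧ h126`] **`exists_decay510_crossWord_road_loc`**: ONE n-free `kG, K ≥ 0`, `c > 0` such that for every `m`, every `LocStencil S Cs δS` and every
  pair pack body `(Ck, δ₂)`: tadpole `Decay510 … (½·(K∕2∕n²·(C_T(δ₂)·(n⁶)⁻¹·(16·Ck·Zl 4 (δ₂∕2)²)))) (min (κ′∕8) (δ₂∕2))`, bubbles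
  `Decay510 … (½·(L_x·L_y·(C_V·n⁻¹·(16·Cs·Zl 4 (δS∕2)²))²)) (min c (δS∕2))` — both rates n-FREE; the jets' rate is `σ := min c (δS∕2)∕n`.
Unit `b2b-balaban-beta-d1-formalise-leaf-01` (gen 22), D1 formalisation swarm leaf prover 01, road «BF-x»; INTENT «RK-SAND AT SELF-LOCALISED PACKS» (journal).
-/

noncomputable section

open Finset
open scoped BigOperators
open Literature.MathematicalPhysics.QuantumFieldTheory.Balaban1983to89
open Literature.MathematicalPhysics.QuantumFieldTheory.Balaban1983to89.Beta
open B12Sec2to5 (l1 l1_nonneg Decay510)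
open B5Hk163Strip (kappa163 kappa163_pos)
open B5Hk163Decay (MG163)
open B4TorusKernel (periodConst)
open ExpKernelCalculus (Site MKer BiLoc Zl Zl_nonneg summable_exp_shift' tsum_exp_shift')
open SecondOrderResponse (vertex2OfK)
open OneStepResolventKernel (Fib LocStencil)
open OneStepKernelFamily (vertexOfK)
open VectorTailsLoc (fam kfam)
open Summit.QuantumFields.BalabanUV.Beta.D1BFx.PackedKernelSplit (blk ffV ffW biLoc_blk)
open Summit.QuantumFields.BalabanUV.Beta.D1BFx.CoarseGramInverse (multM)
open Summit.QuantumFields.BalabanUV.Beta.D1BFx.RWeightedLegPack (sandP NlegRoad)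
open Summit.QuantumFields.BalabanUV.Beta.D1BFx.GluonLeg (Ga)
open Summit.QuantumFields.BalabanUV.Beta.D1BFx.FrozenLegTails (nOf MOf hn1)
open Summit.QuantumFields.BalabanUV.Beta.D1BFx.RestKernelWords (crossWord)
open Summit.QuantumFields.BalabanUV.Beta.D1BFx.RestKernelSandwichPacked (exists_decay510_crossWord_road_packed)

namespace Summit.QuantumFields.BalabanUV.Beta.D1BFx.RestKernelSandwichLoc

/-! ## §1 Pack letters from self-localisation -/

section Mass

variable {D : ℕ} {F : Type*} [Fintype F]

/-- [folklore] **THE CENTRED WEIGHTED MASS OF A BI-LOCALISED KERNEL**: `BiLoc K u u C δ`, `0 ≤ C`, `0 < δ`, `σ ≤ δ∕2` ⊢ the `σ`-weighted mass centred at `u`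
is summable and `≤ |F|²·C·Zl D (δ∕2)²` (half the rate absorbs the weight; any real `σ ≤ δ∕2`). -/
theorem mass_le_of_biLoc {K : MKer D F} {u : Site D} {C δ σ : ℝ} (hK : BiLoc K u u C δ) (hC : 0 ≤ C) (hδ : 0 < δ)
    (hσ : σ ≤ δ / 2) :
    (Summable fun p : Site D × Site D => ∑ a, ∑ b, |K p.1 p.2 a b| * Real.exp (σ * (l1 (p.1 - u) + l1 (p.2 - u)))) ∧
      ∑' p : Site D × Site D, ∑ a, ∑ b, |K p.1 p.2 a b| * Real.exp (σ * (l1 (p.1 - u) + l1 (p.2 - u)))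
        ≤ (Fintype.card F : ℝ) ^ 2 * C * Zl D (δ / 2) ^ 2 := by
  have hδ2 : 0 < δ / 2 := half_pos hδ
  -- termwise majorant: `|K x y a b|·e^{σ(|x−u|+|y−u|)} ≤ C·e^{−(δ∕2)|x−u|}·e^{−(δ∕2)|y−u|}`
  have hpt : ∀ (x y : Site D) (a b : F), |K x y a b| * Real.exp (σ * (l1 (x - u) + l1 (y - u)))
      ≤ C * (Real.exp (-(δ / 2) * l1 (x - u)) * Real.exp (-(δ / 2) * l1 (y - u))) := by
    intro x y a b
    have h1 := hK x y a b
    have hl : 0 ≤ l1 (x - u) + l1 (y - u) := add_nonneg (l1_nonneg _) (l1_nonneg _)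
    calc |K x y a b| * Real.exp (σ * (l1 (x - u) + l1 (y - u)))
        ≤ C * Real.exp (-δ * (l1 (x - u) + l1 (y - u))) * Real.exp (σ * (l1 (x - u) + l1 (y - u))) :=
          mul_le_mul_of_nonneg_right h1 (Real.exp_nonneg _)
      _ = C * Real.exp ((σ - δ) * (l1 (x - u) + l1 (y - u))) := by
          rw [mul_assoc, ← Real.exp_add]; ring_nf
      _ ≤ C * Real.exp (-(δ / 2) * (l1 (x - u) + l1 (y - u))) := by
          refine mul_le_mul_of_nonneg_left (Real.exp_le_exp.2 ?_) hC
          exact mul_le_mul_of_nonneg_right (by linarith) hl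
      _ = C * (Real.exp (-(δ / 2) * l1 (x - u)) * Real.exp (-(δ / 2) * l1 (y - u))) := by
          rw [mul_add, Real.exp_add]
  -- the majorant `p ↦ |F|²·C·e^{−(δ∕2)|p.1−u|}·e^{−(δ∕2)|p.2−u|}` is summable with sum `|F|²·C·Zl²`
  set g : Site D × Site D → ℝ := fun p => (Fintype.card F : ℝ) ^ 2 * C
      * (Real.exp (-(δ / 2) * l1 (p.1 - u)) * Real.exp (-(δ / 2) * l1 (p.2 - u))) with hg
  have hgs : Summable g := by
    have h := ((summable_exp_shift' hδ2 u).mul_of_nonneg (summable_exp_shift' hδ2 u)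
      (fun _ => (Real.exp_pos _).le) (fun _ => (Real.exp_pos _).le)).mul_left ((Fintype.card F : ℝ) ^ 2 * C)
    exact h
  have hle : ∀ p : Site D × Site D, ∑ a, ∑ b, |K p.1 p.2 a b| * Real.exp (σ * (l1 (p.1 - u) + l1 (p.2 - u))) ≤ g p := by
    intro p
    calc ∑ a, ∑ b, |K p.1 p.2 a b| * Real.exp (σ * (l1 (p.1 - u) + l1 (p.2 - u)))
        ≤ ∑ _a : F, ∑ _b : F, C * (Real.exp (-(δ / 2) * l1 (p.1 - u)) * Real.exp (-(δ / 2) * l1 (p.2 - u))) :=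
          Finset.sum_le_sum fun a _ => Finset.sum_le_sum fun b _ => hpt p.1 p.2 a b
      _ = g p := by
          simp only [Finset.sum_const, Finset.card_univ, hg]; ring
  have h0 : ∀ p : Site D × Site D, 0 ≤ ∑ a, ∑ b, |K p.1 p.2 a b| * Real.exp (σ * (l1 (p.1 - u) + l1 (p.2 - u))) :=
    fun p => Finset.sum_nonneg fun a _ => Finset.sum_nonneg fun b _ => by positivity
  have hs : Summable fun p : Site D × Site D => ∑ a, ∑ b, |K p.1 p.2 a b| * Real.exp (σ * (l1 (p.1 - u) + l1 (p.2 - u))) :=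
    Summable.of_nonneg_of_le h0 hle hgs
  refine ⟨hs, ?_⟩
  calc ∑' p : Site D × Site D, ∑ a, ∑ b, |K p.1 p.2 a b| * Real.exp (σ * (l1 (p.1 - u) + l1 (p.2 - u)))
      ≤ ∑' p, g p := hs.tsum_le_tsum hle hgs
    _ = (Fintype.card F : ℝ) ^ 2 * C * Zl D (δ / 2) ^ 2 := by
        have hn : Summable fun x : Site D => ‖Real.exp (-(δ / 2) * l1 (x - u))‖ := by
          simpa only [Real.norm_eq_abs, abs_of_nonneg (Real.exp_pos _).le] using summable_exp_shift' hδ2 u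
        rw [hg, tsum_mul_left, ← tsum_mul_tsum_of_summable_norm hn hn, tsum_exp_shift']
        ring

end Mass

/-- [folklore] **THE BLOCKS OF A SELF-LOCALISED FIRST-JET PACK HAVE CENTRED WEIGHTED MASSES `≤ 16·Cs·Zl 4 (δS∕2)²`** (`LocStencil S Cs δS`, any rate
`σ ≤ δS∕2`; fibre `Fib 3`, blocks of fibre `Fin 4`). -/
theorem mass_blk_le_of_locStencil {S : Fin 4 → Site 4 → MKer 4 (Fib 3)} {Cs δS σ : ℝ} (hS : LocStencil S Cs δS) (hCs : 0 ≤ Cs) (hδS : 0 < δS)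
    (hσ : σ ≤ δS / 2) (κ : Fin 4) (u : Site 4) (j k : Bool) :
    (Summable fun p : Site 4 × Site 4 => ∑ g, ∑ f, |blk (S κ u) j k p.1 p.2 g f| * Real.exp (σ * (l1 (p.1 - u) + l1 (p.2 - u)))) ∧
      ∑' p : Site 4 × Site 4, ∑ g, ∑ f, |blk (S κ u) j k p.1 p.2 g f| * Real.exp (σ * (l1 (p.1 - u) + l1 (p.2 - u)))
        ≤ 16 * Cs * Zl 4 (δS / 2) ^ 2 := by
  have h := mass_le_of_biLoc (biLoc_blk (hS κ u) j k) hCs hδS hσ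
  have e : (Fintype.card (Fin 4) : ℝ) ^ 2 = 16 := by norm_num [Fintype.card_fin]
  rw [e] at h
  exact h

/-- [folklore] **THE BLOCKS OF A PAIR PACK WITH THE `LocStencil₂` BODY HAVE PLAIN MASSES `≤ (16·Ck·Zl 4 (δ₂∕2)²)·e^{−δ₂|u′−u|₁}`.** -/
theorem mass_blk_le_of_body {S₂ : Fin 4 → Site 4 → Fin 4 → Site 4 → MKer 4 (Fib 3)} {Ck δ₂ : ℝ}
    (hS₂ : ∀ κ u κ' u', BiLoc (S₂ κ u κ' u') u u (Ck * Real.exp (-δ₂ * l1 (u' - u))) δ₂) (hCk : 0 ≤ Ck) (hδ₂ : 0 < δ₂)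
    (κ : Fin 4) (u : Site 4) (κ' : Fin 4) (u' : Site 4) (j i : Bool) :
    (Summable fun p : Site 4 × Site 4 => ∑ g, ∑ f, |blk (S₂ κ u κ' u') j i p.1 p.2 g f|) ∧
      ∑' p : Site 4 × Site 4, ∑ g, ∑ f, |blk (S₂ κ u κ' u') j i p.1 p.2 g f|
        ≤ 16 * Ck * Zl 4 (δ₂ / 2) ^ 2 * Real.exp (-δ₂ * l1 (u' - u)) := by
  have hC : 0 ≤ Ck * Real.exp (-δ₂ * l1 (u' - u)) := by positivity
  have h := mass_le_of_biLoc (σ := 0) (biLoc_blk (hS₂ κ u κ' u') j i) hC hδ₂ (by positivity)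
  simp only [zero_mul, Real.exp_zero, mul_one] at h
  have e : (Fintype.card (Fin 4) : ℝ) ^ 2 = 16 := by norm_num [Fintype.card_fin]
  rw [e] at h
  refine ⟨h.1, h.2.trans (le_of_eq ?_)⟩
  ring

/-! ## §2 The road's sandwich words at self-localised packs (mod `h12 ∧ h126`) -/

section Road

variable {a : ℝ} (ha : 0 < a)
include ha

/-- [folklore] **«RK-SAND AT SELF-LOCALISED PACKS»** (mod [B5, Prop. 1.2] ∧ [B5, (1.126)–(1.127)] BY NAME): ONE n-free triple `kG, K ≥ 0`, `c > 0` such that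
for every `m` (`n = m + 1`), every self-localised first-jet pack `LocStencil S Cs δS` and every pair pack with the `LocStencil₂` body `(Ck, δ₂)`, the four
sandwich cross words at the packed N-jets `ffV (vertexOfK (NlegRoad m a) n S)`, `ffW (vertex2OfK (NlegRoad m a) n S₂)` satisfy: tadpole
`Decay510 … (½·(K∕2∕n²·(C_T(δ₂)·(n⁶)⁻¹·(16·Ck·Zl 4 (δ₂∕2)²)))) (min (κ′∕8) (δ₂∕2))`; bubbles `Decay510 … (½·(L_x·L_y·M·M)) (min c (δS∕2))`,
`M := C_V·n⁻¹·(16·Cs·Zl 4 (δS∕2)²)`, `L_true = K∕2∕n²`, `L_false = kG∕2` — «RK-SAND PACKED-IN-STENCILS» at the jets' rate `σ := min c (δS∕2)∕n` with the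
pack letters of §1. -/
theorem exists_decay510_crossWord_road_loc (h12 : B5.Prop12Printed (fam nOf hn1 MOf a ha)) (h126 : B5.Kernel126_127Printed (kfam nOf MOf)) :
    ∃ kG K c : ℝ, 0 < c ∧ 0 ≤ kG ∧ 0 ≤ K ∧ ∀ (m : ℕ) (S : Fin 4 → Site 4 → MKer 4 (Fib 3))
      (S₂ : Fin 4 → Site 4 → Fin 4 → Site 4 → MKer 4 (Fib 3)) (Cs δS Ck δ₂ : ℝ) (μ ν : Fin 4),
      LocStencil S Cs δS → 0 ≤ Cs → 0 < δS →
      (∀ κ u κ' u', BiLoc (S₂ κ u κ' u') u u (Ck * Real.exp (-δ₂ * l1 (u' - u))) δ₂) → 0 ≤ Ck → 0 < δ₂ →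
      (∀ u : Unit, Decay510 (crossWord ((2 : ℝ)⁻¹ • Ga (m + 1) a)
          ((-(2 : ℝ)⁻¹) • blk (sandP (m + 1) (Ga (m + 1) a) (multM (m + 1) (2 * a / ((m + 1 : ℕ) : ℝ) ^ 8) 2)) true true)
          (ffV (vertexOfK (NlegRoad m a) (m + 1) S)) (ffW (vertex2OfK (NlegRoad m a) (m + 1) S₂)) (Sum.inl u) μ ν)
          ((1 / 2) * (K / 2 / (((m + 1 : ℕ) : ℝ)) ^ 2
            * (16 * ((MG163 4 * periodConst (kappa163 4) 3) * Real.exp (kappa163 4 / 4)) ^ 2 * (1 + 16 / (kappa163 4 / 4)) ^ 4 * Zl 4 (δ₂ / 2)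
                * ((((m + 1 : ℕ) : ℝ)) ^ 6)⁻¹ * (16 * Ck * Zl 4 (δ₂ / 2) ^ 2))))
          (min (kappa163 4 / 4 / 8) (δ₂ / 2))) ∧
      (∀ x y : Bool, Decay510 (crossWord ((2 : ℝ)⁻¹ • Ga (m + 1) a)
          ((-(2 : ℝ)⁻¹) • blk (sandP (m + 1) (Ga (m + 1) a) (multM (m + 1) (2 * a / ((m + 1 : ℕ) : ℝ) ^ 8) 2)) true true)
          (ffV (vertexOfK (NlegRoad m a) (m + 1) S)) (ffW (vertex2OfK (NlegRoad m a) (m + 1) S₂)) (Sum.inr (x, y)) μ ν)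
          ((1 / 2) * ((bif x then K / 2 / (((m + 1 : ℕ) : ℝ)) ^ 2 else kG / 2) * (bif y then K / 2 / (((m + 1 : ℕ) : ℝ)) ^ 2 else kG / 2)
            * (4 * (MG163 4 * periodConst (kappa163 4) 3) * Real.exp (kappa163 4 / 4) * (1 + 16 / (kappa163 4 / 4)) ^ 4
                * (((m + 1 : ℕ) : ℝ))⁻¹ * (16 * Cs * Zl 4 (δS / 2) ^ 2))
            * (4 * (MG163 4 * periodConst (kappa163 4) 3) * Real.exp (kappa163 4 / 4) * (1 + 16 / (kappa163 4 / 4)) ^ 4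
                * (((m + 1 : ℕ) : ℝ))⁻¹ * (16 * Cs * Zl 4 (δS / 2) ^ 2))))
          (min c (δS / 2))) := by
  obtain ⟨kG, K, c, hc, hkG, hK, hpk⟩ := exists_decay510_crossWord_road_packed ha h12 h126
  refine ⟨kG, K, c, hc, hkG, hK, fun m S S₂ Cs δS Ck δ₂ μ ν hS hCs hδS hS₂ hCk hδ₂ => ?_⟩
  have hn0 : (0 : ℝ) < ((m + 1 : ℕ) : ℝ) := by exact_mod_cast Nat.succ_pos m
  have hn1 : (1 : ℝ) ≤ ((m + 1 : ℕ) : ℝ) := by exact_mod_cast Nat.succ_le_succ (Nat.zero_le m)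
  -- the jets' rate `σ := min c (δS∕2)∕n`: below `c∕n` and below `δS∕2`
  set σ : ℝ := min c (δS / 2) / ((m + 1 : ℕ) : ℝ) with hσdef
  have hmin0 : 0 < min c (δS / 2) := lt_min hc (half_pos hδS)
  have hσ0 : 0 ≤ σ := by positivity
  have hσc : σ ≤ c / ((m + 1 : ℕ) : ℝ) := div_le_div_of_nonneg_right (min_le_left _ _) hn0.le
  have hσS : σ ≤ δS / 2 := by
    calc σ ≤ min c (δS / 2) / 1 := div_le_div_of_nonneg_left hmin0.le one_pos hn1
      _ ≤ δS / 2 := by rw [div_one]; exact min_le_right _ _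
  have hV := fun κ' u j k => mass_blk_le_of_locStencil (σ := σ) hS hCs hδS hσS κ' u j k
  have hT := fun κ u κ' u' j i => mass_blk_le_of_body hS₂ hCk hδ₂ κ u κ' u' j i
  obtain ⟨hinl, hinr⟩ := hpk m S S₂ σ δ₂ (fun _ _ => 16 * Cs * Zl 4 (δS / 2) ^ 2) (fun _ _ => 16 * Ck * Zl 4 (δ₂ / 2) ^ 2) μ ν
    hσ0 hσc hδ₂ (fun κ' u j k => (hV κ' u j k).1) (fun κ' u j k => (hV κ' u j k).2)
    (fun κ u κ' u' j i => (hT κ u κ' u' j i).1) (fun κ u κ' u' j i => (hT κ u κ' u' j i).2)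
  have e : σ * ((m + 1 : ℕ) : ℝ) = min c (δS / 2) := div_mul_cancel₀ _ hn0.ne'
  rw [e] at hinr
  exact ⟨hinl, hinr⟩

end Road

end Summit.QuantumFields.BalabanUV.Beta.D1BFx.RestKernelSandwichLoc

end
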